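import Summits.Ventures.PercRepro.C041TriDomTwoExitPiece

/-!
# ROW C-041 — THE FAR SIDE OF A 2-CUT, I: THE THROUGH-LEMMA
(p6, gen 46; P6-TWOEXIT-LEAN.md §53 ADDENDUM 18)

Two vertices `u ≠ v` and a vertex `w` off them; `C = side2 Z₁ st u v w` is the FAR SIDE of the pair seen from `w`
(the vertices reachable from `w` by present edges avoiding `u` and `v`), `InC2S` the edges touching it, `stOut2S` /
`stIn2S` the status with the far side deleted / kept alone.  Unlike a cut vertex, a pair lets a walk pass THROUGH
the far side: in from `u`, out at `v`.  **THE THROUGH-LEMMA** (`rtg_twoCut_iff`): for two vertices `a, b` off `C`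
and any colour predicate `col` on present edges, `a` reaches `b` through `col`-edges iff it does through the
`col`-edges off `C` together with the CHORD `u–v`, the chord being available exactly when `u` reaches `v` through
the `col`-edges of the far side (`ThroughFar`).  Proof: induction on the walk with a three-state invariant — a vertex
off `C` is reached through the chord relation; a vertex of `C` is reached, inside the far side, from an ANCHOR `u` or
`v` that is itself reached through the chord relation (`rtg_twoCut_aux`); an edge touching `C` with an end off `C`
ends at `u` or `v` (`end_of_touch`), and a walk inside `C` that leaves at the other anchor has shown `u ~ v` through
the far side.  In colours: `RdS_st_iff_chord`, `MgS_st_iff_chord`.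
-/

namespace PercRepro

namespace ZoneZ

namespace MultiExit

open ZoneData Finset

variable {V₁ E₁ U₁ U₂ : Type} (Z₁ : ZoneData V₁ E₁ U₁ U₂) (st : E₁ → EStat) (u v w : V₁)

/-! ## The far side of a pair -/

/-- Present adjacency avoiding the two vertices `u, v`. -/
def PAdjAvoid2 (x y : V₁) : Prop := PAdjS Z₁ st x y ∧ x ≠ u ∧ x ≠ v ∧ y ≠ u ∧ y ≠ v

/-- The far side of the pair `{u, v}` seen from `w`: the vertices reachable from `w` avoiding `u` and `v`. -/
def side2 : Set V₁ := ZoneData.reach (PAdjAvoid2 Z₁ st u v) {w}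

/-- The edges of the far side: those touching it. -/
def InC2S : E₁ → Prop := fun e => Z₁.Touches (side2 Z₁ st u v w) e

open Classical in
/-- The status with the far side deleted. -/
noncomputable def stOut2S : E₁ → EStat := fun e => if InC2S Z₁ st u v w e then EStat.absent else st e

open Classical in
/-- The status with only the far side kept. -/
noncomputable def stIn2S : E₁ → EStat := fun e => if InC2S Z₁ st u v w e then st e else EStat.absent

/-- Red under `stOut2S`: off the far side and red under `st`. -/
theorem redE_stOut2S (ω : E₁ → Bool) (e : E₁) :
    redE (stOut2S Z₁ st u v w) ω e ↔ ¬ InC2S Z₁ st u v w e ∧ redE st ω e := by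
  unfold stOut2S
  by_cases h : InC2S Z₁ st u v w e <;> simp [redE, h]

/-- Blue under `stOut2S`: off the far side and blue under `st`. -/
theorem blueE_stOut2S (ω : E₁ → Bool) (e : E₁) :
    blueE (stOut2S Z₁ st u v w) ω e ↔ ¬ InC2S Z₁ st u v w e ∧ blueE st ω e := by
  unfold stOut2S
  by_cases h : InC2S Z₁ st u v w e <;> simp [blueE, h]

/-- Red under `stIn2S`: on the far side and red under `st`. -/
theorem redE_stIn2S (ω : E₁ → Bool) (e : E₁) :
    redE (stIn2S Z₁ st u v w) ω e ↔ InC2S Z₁ st u v w e ∧ redE st ω e := by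
  unfold stIn2S
  by_cases h : InC2S Z₁ st u v w e <;> simp [redE, h]

/-- Blue under `stIn2S`: on the far side and blue under `st`. -/
theorem blueE_stIn2S (ω : E₁ → Bool) (e : E₁) :
    blueE (stIn2S Z₁ st u v w) ω e ↔ InC2S Z₁ st u v w e ∧ blueE st ω e := by
  unfold stIn2S
  by_cases h : InC2S Z₁ st u v w e <;> simp [blueE, h]

variable {st u v w}

/-- A vertex of the far side is neither `u` nor `v`. -/
theorem ne_of_mem_side2 (hwu : w ≠ u) (hwv : w ≠ v) {x : V₁} (hx : x ∈ side2 Z₁ st u v w) : x ≠ u ∧ x ≠ v := by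
  unfold side2 at hx
  rw [mem_reach_singleton] at hx
  induction hx with
  | refl => exact ⟨hwu, hwv⟩
  | tail _ hxy _ => exact ⟨hxy.2.2.2.1, hxy.2.2.2.2⟩

/-- The far side is closed under present edges that do not end at `u` or `v`. -/
theorem side2_closed (hwu : w ≠ u) (hwv : w ≠ v) {x y : V₁} (hx : x ∈ side2 Z₁ st u v w) {e : E₁}
    (he : presE st e) (hxy : Z₁.Joins e x y) (hyu : y ≠ u) (hyv : y ≠ v) : y ∈ side2 Z₁ st u v w := by
  have hxuv := ne_of_mem_side2 Z₁ hwu hwv hx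
  unfold side2 at hx ⊢
  rw [mem_reach_singleton] at hx ⊢
  exact hx.tail ⟨⟨e, hxy, he⟩, hxuv.1, hxuv.2, hyu, hyv⟩

/-- `u` is off the far side. -/
theorem u_not_mem_side2 (hwu : w ≠ u) (hwv : w ≠ v) : u ∉ side2 Z₁ st u v w :=
  fun h => (ne_of_mem_side2 Z₁ hwu hwv h).1 rfl

/-- `v` is off the far side. -/
theorem v_not_mem_side2 (hwu : w ≠ u) (hwv : w ≠ v) : v ∉ side2 Z₁ st u v w :=
  fun h => (ne_of_mem_side2 Z₁ hwu hwv h).2 rfl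

/-- A present edge from the far side to a vertex off it ends at `u` or `v`. -/
theorem end_of_touch (hwu : w ≠ u) (hwv : w ≠ v) {e : E₁} {x y : V₁} (he : presE st e) (hxy : Z₁.Joins e x y)
    (hx : x ∈ side2 Z₁ st u v w) (hy : y ∉ side2 Z₁ st u v w) : y = u ∨ y = v := by
  by_contra h
  rw [not_or] at h
  exact hy (side2_closed Z₁ hwu hwv hx he hxy h.1 h.2)

/-- An edge touching the far side joins two vertices of which at least one is on it. -/
theorem mem_side2_of_touch {e : E₁} {x y : V₁} (hxy : Z₁.Joins e x y) (ht : InC2S Z₁ st u v w e) :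
    x ∈ side2 Z₁ st u v w ∨ y ∈ side2 Z₁ st u v w :=
  (touches_iff_of_joins Z₁ _ hxy).mp ht

/-- An edge not touching the far side joins two vertices off it. -/
theorem not_mem_side2_of_not_touch {e : E₁} {x y : V₁} (hxy : Z₁.Joins e x y) (ht : ¬ InC2S Z₁ st u v w e) :
    x ∉ side2 Z₁ st u v w ∧ y ∉ side2 Z₁ st u v w := by
  unfold InC2S at ht
  rw [touches_iff_of_joins Z₁ _ hxy, not_or] at ht
  exact ht

/-! ## The through-lemma -/

variable (u v)

/-- The chord relation: `u–v`. -/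
def Chord (x y : V₁) : Prop := (x = u ∧ y = v) ∨ (x = v ∧ y = u)

variable (st w)

/-- `u` reaches `v` through the `col`-edges of the far side. -/
def ThroughFar (col : E₁ → Prop) : Prop :=
  v ∈ ZoneData.reach (AdjCol Z₁ fun e => col e ∧ InC2S Z₁ st u v w e) {u}

/-- The chord relation of a colour predicate: adjacency through the `col`-edges off the far side, plus the chord when
`u` reaches `v` through the far side. -/
def AdjChord (col : E₁ → Prop) (x y : V₁) : Prop :=
  AdjCol Z₁ (fun e => col e ∧ ¬ InC2S Z₁ st u v w e) x y ∨ (ThroughFar Z₁ st u v w col ∧ Chord u v x y)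

/-- Reachability inside the far side from an anchor `α`, through the `col`-edges of the far side. -/
def FarReach (col : E₁ → Prop) (α c : V₁) : Prop :=
  c ∈ ZoneData.reach (AdjCol Z₁ fun e => col e ∧ InC2S Z₁ st u v w e) {α}

/-- The red chord relation of `st` and `ω`. -/
def RedChord (ω : E₁ → Bool) (x y : V₁) : Prop :=
  RAdjS Z₁ (stOut2S Z₁ st u v w) ω x y ∨ (RdS Z₁ (stIn2S Z₁ st u v w) ω u v ∧ Chord u v x y)

/-- The blue chord relation of `st` and `ω`. -/
def BlueChord (ω : E₁ → Bool) (x y : V₁) : Prop :=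
  BAdjS Z₁ (stOut2S Z₁ st u v w) ω x y ∨ (MgS Z₁ (stIn2S Z₁ st u v w) ω u v ∧ Chord u v x y)

variable {st u v w}

/-- The chord relation is symmetric. -/
theorem AdjChord_symm (col : E₁ → Prop) (x y : V₁) (h : AdjChord Z₁ st u v w col x y) :
    AdjChord Z₁ st u v w col y x := by
  rcases h with h | ⟨ht, h⟩
  · exact Or.inl (AdjCol_symm Z₁ _ x y h)
  · refine Or.inr ⟨ht, ?_⟩
    unfold Chord at h ⊢
    rcases h with ⟨h1, h2⟩ | ⟨h1, h2⟩
    · exact Or.inr ⟨h2, h1⟩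
    · exact Or.inl ⟨h2, h1⟩

/-- The three-state invariant of a walk from a vertex `a` off the far side. -/
theorem rtg_twoCut_aux (hwu : w ≠ u) (hwv : w ≠ v) {col : E₁ → Prop} (hcol : ∀ e, col e → presE st e)
    {a c : V₁} (ha : a ∉ side2 Z₁ st u v w) (h : Relation.ReflTransGen (AdjCol Z₁ col) a c) :
    (c ∉ side2 Z₁ st u v w ∧ Relation.ReflTransGen (AdjChord Z₁ st u v w col) a c) ∨
      (c ∈ side2 Z₁ st u v w ∧
        ((Relation.ReflTransGen (AdjChord Z₁ st u v w col) a u ∧ FarReach Z₁ st u v w col u c) ∨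
          (Relation.ReflTransGen (AdjChord Z₁ st u v w col) a v ∧ FarReach Z₁ st u v w col v c))) := by
  induction h with
  | refl => exact Or.inl ⟨ha, Relation.ReflTransGen.refl⟩
  | @tail c d _ hcd ih =>
    obtain ⟨e, hj, hce⟩ := hcd
    by_cases ht : InC2S Z₁ st u v w e
    · -- the edge touches the far side
      rcases ih with ⟨hcC, hac⟩ | ⟨hcC, hanc⟩
      · -- `c` off the side: `c` is an anchor, `d` is on the side
        have hdC : d ∈ side2 Z₁ st u v w := by
          rcases mem_side2_of_touch Z₁ hj ht with h | h
          · exact absurd h hcC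
          · exact h
        have hcuv : c = u ∨ c = v := end_of_touch Z₁ hwu hwv (hcol e hce) (Joins_symm Z₁ hj) hdC hcC
        have hstep : FarReach Z₁ st u v w col c d :=
          (mem_reach_singleton _ _ _).mpr (Relation.ReflTransGen.single ⟨e, hj, hce, ht⟩)
        refine Or.inr ⟨hdC, ?_⟩
        rcases hcuv with hcu | hcv
        · rw [hcu] at hac hstep
          exact Or.inl ⟨hac, hstep⟩
        · rw [hcv] at hac hstep
          exact Or.inr ⟨hac, hstep⟩
      · -- `c` on the side, anchored
        by_cases hdC : d ∈ side2 Z₁ st u v w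
        · refine Or.inr ⟨hdC, ?_⟩
          rcases hanc with ⟨hau, hfc⟩ | ⟨hav, hfc⟩
          · exact Or.inl ⟨hau, reach_trans' hfc ((mem_reach_singleton _ _ _).mpr
              (Relation.ReflTransGen.single ⟨e, hj, hce, ht⟩))⟩
          · exact Or.inr ⟨hav, reach_trans' hfc ((mem_reach_singleton _ _ _).mpr
              (Relation.ReflTransGen.single ⟨e, hj, hce, ht⟩))⟩
        · -- `d` leaves the side: at an anchor
          have hduv : d = u ∨ d = v := end_of_touch Z₁ hwu hwv (hcol e hce) hj hcC hdC
          refine Or.inl ⟨hdC, ?_⟩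
          have hstep : FarReach Z₁ st u v w col c d :=
            (mem_reach_singleton _ _ _).mpr (Relation.ReflTransGen.single ⟨e, hj, hce, ht⟩)
          have hsymm : ∀ x y, AdjCol Z₁ (fun e => col e ∧ InC2S Z₁ st u v w e) x y →
              AdjCol Z₁ (fun e => col e ∧ InC2S Z₁ st u v w e) y x := fun x y => AdjCol_symm Z₁ _ x y
          rcases hanc with ⟨hau, hfc⟩ | ⟨hav, hfc⟩
          · rcases hduv with hdu | hdv
            · rw [hdu]
              exact hau
            · -- from `u` through the side to `d = v`: the chord is available
              rw [hdv] at hstep ⊢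
              have hthr : ThroughFar Z₁ st u v w col := reach_trans' hfc hstep
              exact hau.tail (Or.inr ⟨hthr, Or.inl ⟨rfl, rfl⟩⟩)
          · rcases hduv with hdu | hdv
            · rw [hdu] at hstep ⊢
              have hthr : ThroughFar Z₁ st u v w col :=
                reach_trans_of_symm hsymm (reach_trans' hfc hstep) (mem_reach_self _ _)
              exact hav.tail (Or.inr ⟨hthr, Or.inr ⟨rfl, rfl⟩⟩)
            · rw [hdv]
              exact hav
    · -- the edge is off the far side: both ends off it
      have hcd := not_mem_side2_of_not_touch Z₁ hj ht
      rcases ih with ⟨_, hac⟩ | ⟨hcC, _⟩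
      · exact Or.inl ⟨hcd.2, hac.tail (Or.inl ⟨e, hj, hce, ht⟩)⟩
      · exact absurd hcC hcd.1

/-- A walk of the chord relation is a walk of the colour. -/
theorem rtg_of_rtg_chord {col : E₁ → Prop} {a b : V₁}
    (h : Relation.ReflTransGen (AdjChord Z₁ st u v w col) a b) :
    Relation.ReflTransGen (AdjCol Z₁ col) a b := by
  induction h with
  | refl => exact Relation.ReflTransGen.refl
  | @tail c d _ hcd ih =>
    rcases hcd with ⟨e, hj, hce, _⟩ | ⟨hthr, hch⟩
    · exact ih.tail ⟨e, hj, hce⟩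
    · unfold ThroughFar at hthr
      rw [mem_reach_singleton] at hthr
      have hthr' : Relation.ReflTransGen (AdjCol Z₁ col) u v :=
        Relation.ReflTransGen.mono (fun x y hxy => AdjCol_mono Z₁ (fun _ he => he.1) x y hxy) _ _ hthr
      unfold Chord at hch
      rcases hch with ⟨hcu, hdv⟩ | ⟨hcv, hdu⟩
      · rw [hdv]
        rw [hcu] at ih
        exact ih.trans hthr'
      · rw [hdu]
        rw [hcv] at ih
        exact ih.trans (rtg_symm (AdjCol_symm Z₁ col) hthr')

/-- **THE THROUGH-LEMMA**: between two vertices off the far side, connectivity through `col` is connectivity through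
the chord relation. -/
theorem rtg_twoCut_iff (hwu : w ≠ u) (hwv : w ≠ v) {col : E₁ → Prop} (hcol : ∀ e, col e → presE st e)
    {a b : V₁} (ha : a ∉ side2 Z₁ st u v w) (hb : b ∉ side2 Z₁ st u v w) :
    Relation.ReflTransGen (AdjCol Z₁ col) a b ↔ Relation.ReflTransGen (AdjChord Z₁ st u v w col) a b := by
  constructor
  · intro h
    rcases rtg_twoCut_aux Z₁ hwu hwv hcol ha h with ⟨_, hab⟩ | ⟨hbC, _⟩
    · exact hab
    · exact absurd hbC hb
  · exact rtg_of_rtg_chord Z₁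

/-! ## In colours -/

/-- The chord relation of the red edges is the red chord relation. -/
theorem AdjChord_red (ω : E₁ → Bool) : AdjChord Z₁ st u v w (redE st ω) = RedChord Z₁ st u v w ω := by
  have h1 : (fun e => redE st ω e ∧ ¬ InC2S Z₁ st u v w e) = redE (stOut2S Z₁ st u v w) ω := by
    funext e
    rw [redE_stOut2S]
    exact propext and_comm
  have h2 : (fun e => redE st ω e ∧ InC2S Z₁ st u v w e) = redE (stIn2S Z₁ st u v w) ω := by
    funext e
    rw [redE_stIn2S]
    exact propext and_comm
  funext x y
  unfold AdjChord ThroughFar RedChord RdS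
  rw [RAdjS_eq_AdjCol, RAdjS_eq_AdjCol, h1, h2]

/-- The chord relation of the blue edges is the blue chord relation. -/
theorem AdjChord_blue (ω : E₁ → Bool) : AdjChord Z₁ st u v w (blueE st ω) = BlueChord Z₁ st u v w ω := by
  have h1 : (fun e => blueE st ω e ∧ ¬ InC2S Z₁ st u v w e) = blueE (stOut2S Z₁ st u v w) ω := by
    funext e
    rw [blueE_stOut2S]
    exact propext and_comm
  have h2 : (fun e => blueE st ω e ∧ InC2S Z₁ st u v w e) = blueE (stIn2S Z₁ st u v w) ω := by
    funext e
    rw [blueE_stIn2S]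
    exact propext and_comm
  funext x y
  unfold AdjChord ThroughFar BlueChord MgS
  rw [BAdjS_eq_AdjCol, BAdjS_eq_AdjCol, h1, h2]

/-- Red connectivity between two vertices off the far side is connectivity through the red chord relation. -/
theorem RdS_st_iff_chord (hwu : w ≠ u) (hwv : w ≠ v) (ω : E₁ → Bool) {a b : V₁} (ha : a ∉ side2 Z₁ st u v w)
    (hb : b ∉ side2 Z₁ st u v w) :
    RdS Z₁ st ω a b ↔ Relation.ReflTransGen (RedChord Z₁ st u v w ω) a b := by
  rw [← AdjChord_red]
  unfold RdS
  rw [RAdjS_eq_AdjCol, mem_reach_singleton]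
  exact rtg_twoCut_iff Z₁ hwu hwv (fun e he => redE_pres he) ha hb

/-- Blue connectivity between two vertices off the far side is connectivity through the blue chord relation. -/
theorem MgS_st_iff_chord (hwu : w ≠ u) (hwv : w ≠ v) (ω : E₁ → Bool) {a b : V₁} (ha : a ∉ side2 Z₁ st u v w)
    (hb : b ∉ side2 Z₁ st u v w) :
    MgS Z₁ st ω a b ↔ Relation.ReflTransGen (BlueChord Z₁ st u v w ω) a b := by
  rw [← AdjChord_blue]
  unfold MgS
  rw [BAdjS_eq_AdjCol, mem_reach_singleton]
  exact rtg_twoCut_iff Z₁ hwu hwv (fun e he => blueE_pres he) ha hb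

end MultiExit

end ZoneZ

end PercRepro
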